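import Summits.KontsevichZagierPeriods.KontsevichZagierPeriods.Theorems.SoloInformedAlgToricTermwise
import HarnessLib

/-!
# THEOREM ND-GEN: all numerators, real algebraic coefficients

Solo programme `solo-KontsevichZagierPeriods-informed`, session s107: the re-base of the
DEN-calculus of the cube crux on a coefficient field `K` of real algebraic numbers, step 5 —
THEOREM ND for ALL numerators `P ∈ K[x₁, …, xₙ]` over a cube-nondegenerate denominator
`Q ∈ K[x]` (`SoloInformedCubeNondegenerateK`), `K` a field with
`hK : ∀ c, IsAlgebraic ℚ (algebraMap K ℝ c)`.

If `r` is an `IntegralRep` whose domain is the open cube (`…_rational_open`), any set between the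
open and the closed cube (`…_rational_of_subset`) or the closed cube (`…_rational`), and whose
integrand agrees with `P/Q` on the open cube, then `of r` is presentable
(`soloInformedPresentable`: `k • of r − ∑ⱼ cⱼ • of ρⱼ ∈ KZ.relations`, `k ≠ 0`, cube integrals `ρⱼ`
of real parts of germs holomorphic near the closed cube, real on real points, algebraic over
`ℚ(z)`).  Proof as for `K = ℚ` (`SoloInformedToricOpenCube`): termwise integrability
(`soloInformed_integrableOn_monomial_divK`), integrand additivity along the support of `P`
through the truncations `[(0,1)ⁿ, P_t/Q]` (`soloInformedOfRationalK`, LEMMA ALG-COEFF), and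
THEOREM ND over `K` for each monomial piece `xᵃ/((coeff_a P)⁻¹ • Q)`.

References: A. G. Kouchnirenko, Invent. Math. 32 (1976) §1; A. N. Varchenko, Funct. Anal. Appl.
10 (1976); J. Ayoub, EMS Newsl. 91 (2014) §2.2; M. Kontsevich, D. Zagier, *Periods* (2001) §1.2.
-/

noncomputable section

open scoped BigOperators
open MeasureTheory Set
open Literature.NumberTheory.Transcendental Literature.NumberTheory.Transcendental.KZ
open Literature.ModelTheory.ExponentialFields (IsSemialgebraic)
open Literature.AlgebraicGeometry.Resolution

namespace Summit.KontsevichZagierPeriods.KontsevichZagierPeriods.Theorems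

variable {n : ℕ} {K : Type*} [Field K] [Algebra K ℝ]

/-- **THEOREM ND-GEN over `K`, open cube.**  Let `P, Q ∈ K[x₁, …, xₙ]` with `Q` cube-nondegenerate
and let `r₀` be an `IntegralRep` on the open cube `(0,1)ⁿ` whose integrand is `P/Q` there.  Then
`of r₀` is presentable. [this work] -/
theorem soloInformed_presentable_of_nondegenerateK_rational_open
    (hK : ∀ c : K, IsAlgebraic ℚ (algebraMap K ℝ c)) (P Q : MvPolynomial (Fin n) K)
    (hND : SoloInformedCubeNondegenerateK Q) (r₀ : IntegralRep n)
    (hr₀ : r₀.domain = soloInformedOpenCube n)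
    (hri : EqOn r₀.integrand (fun x => (MvPolynomial.aeval x P : ℝ) / MvPolynomial.aeval x Q)
      (soloInformedOpenCube n)) :
    of r₀ ∈ soloInformedPresentable := by
  classical
  have hQ : ∀ x ∈ soloInformedOpenCube n, (MvPolynomial.aeval x Q : ℝ) ≠ 0 := fun x hx =>
    soloInformed_aevalK_ne_zero_of_nondegenerate hND fun i => ⟨(hx i).1, (hx i).2.le⟩
  have hint : IntegrableOn (fun x => (MvPolynomial.aeval x P : ℝ) / MvPolynomial.aeval x Q)
      (soloInformedOpenCube n) := by
    have h := r₀.integrableOn.congr_fun (fun x hx => hri (by rwa [hr₀] at hx))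
      r₀.measurableSet_domain_holds
    rwa [hr₀] at h
  -- termwise integrability (Laurent test on the toric charts)
  have hterm : ∀ a ∈ P.support,
      IntegrableOn (fun x => (∏ j, x j ^ a j) / (MvPolynomial.aeval x Q : ℝ))
        (soloInformedOpenCube n) :=
    fun a ha => soloInformed_integrableOn_monomial_divK P Q hND hint ha
  -- the truncated representations `[(0,1)ⁿ, P_t/Q]`
  set ρ : Finset (Fin n →₀ ℕ) → IntegralRep n := fun t =>
    if ht : t ⊆ P.support then
      soloInformedOfRationalK hK (soloInformedOpenCube n) (soloInformedTruncK P t) Q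
        (isSemialgebraic_soloInformedOpenCube n) hQ
        (soloInformed_integrableOn_truncK_div_of_terms P Q t fun a ha => hterm a (ht ha))
    else r₀ with hρ
  have hρdom : ∀ t, (ρ t).domain = soloInformedOpenCube n := fun t => by
    by_cases ht : t ⊆ P.support
    · simp only [hρ, ht, dif_pos]; rfl
    · simp only [hρ, ht, dif_neg, not_false_eq_true]; exact hr₀
  have hρi : ∀ t, t ⊆ P.support → ∀ x, (ρ t).integrand x =
      (MvPolynomial.aeval x (soloInformedTruncK P t) : ℝ) / MvPolynomial.aeval x Q :=
    fun t ht x => by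
    simp only [hρ, ht, dif_pos]; rfl
  -- integrand additivity along the support
  have hsplit : ∀ t, t ⊆ P.support → of (ρ t) - ∑ a ∈ t, of (ρ {a}) ∈ relations := by
    intro t
    induction t using Finset.induction_on with
    | empty =>
      intro _
      rw [Finset.sum_empty, sub_zero]
      exact of_mem_relations_of_eqOn_zero _ fun x _ => by
        rw [hρi ∅ (Finset.empty_subset _)]
        simp [soloInformedTruncK]
    | insert b t hb ih =>
      intro hbt
      have ht : t ⊆ P.support := (Finset.subset_insert b t).trans hbt
      have hb' : {b} ⊆ P.support :=
        Finset.singleton_subset_iff.2 (hbt (Finset.mem_insert_self b t))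
      have h1 : of (ρ (insert b t)) - of (ρ {b}) - of (ρ t) ∈ relations :=
        integrandAddRel_subset_relations ⟨n, ρ (insert b t), ρ {b}, ρ t,
          by rw [hρdom, hρdom], by rw [hρdom, hρdom], fun x _ => by
            rw [Pi.add_apply, hρi _ hbt, hρi _ hb', hρi _ ht, soloInformed_aeval_truncK,
              soloInformed_aeval_truncK, soloInformed_aeval_truncK, Finset.sum_insert hb,
              Finset.sum_singleton, add_div], rfl⟩
      rw [Finset.sum_insert hb]
      have : of (ρ (insert b t)) - (of (ρ {b}) + ∑ a ∈ t, of (ρ {a})) =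
          (of (ρ (insert b t)) - of (ρ {b}) - of (ρ t)) + (of (ρ t) - ∑ a ∈ t, of (ρ {a})) := by
        abel
      rw [this]
      exact relations.add_mem h1 (ih ht)
  -- `r₀` versus the full truncation
  have hfull : of r₀ - of (ρ P.support) ∈ relations :=
    of_sub_of_mem_relations_of_eqOn (by rw [hρdom, hr₀]) fun x hx => by
      rw [hρi _ Subset.rfl, hri (by rwa [hr₀] at hx), soloInformed_truncK_support]
  -- each monomial piece by THEOREM ND over `K`
  have hpiece : ∀ a ∈ P.support, of (ρ {a}) ∈ soloInformedPresentable := by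
    intro a ha
    have hca : MvPolynomial.coeff a P ≠ 0 := MvPolynomial.mem_support_iff.1 ha
    have ha' : {a} ⊆ P.support := Finset.singleton_subset_iff.2 ha
    refine soloInformed_presentable_of_nondegenerateK_of_subset hK a
      ((MvPolynomial.coeff a P)⁻¹ • Q)
      (soloInformed_cubeNondegenerateK_smul hND (inv_ne_zero hca))
      (ρ {a}) (by rw [hρdom]) (by rw [hρdom]; exact soloInformedOpenCube_subset_cube n)
      fun x hx => ?_
    show _ = (∏ j, x j ^ a j) /
      (MvPolynomial.aeval x ((MvPolynomial.coeff a P)⁻¹ • Q) : ℝ)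
    rw [hρi _ ha', soloInformed_aeval_truncK, Finset.sum_singleton, map_smul, Algebra.smul_def,
      map_inv₀]
    have h1 : algebraMap K ℝ (MvPolynomial.coeff a P) ≠ 0 := (map_ne_zero _).2 hca
    have h2 : (MvPolynomial.aeval x Q : ℝ) ≠ 0 := hQ x hx
    field_simp
  -- assemble
  have hsum : ∑ a ∈ P.support, of (ρ {a}) ∈ soloInformedPresentable :=
    soloInformed_presentable_sum _ _ hpiece
  exact soloInformed_presentable_of_sub_mem hfull
    (soloInformed_presentable_of_sub_mem (hsplit _ Subset.rfl) hsum)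

/-- **THEOREM ND-GEN over `K`, sandwich domains**: any `IntegralRep` whose domain lies between the
open and the closed unit cube and whose integrand is `P/Q` on the open cube, `Q ∈ K[x]`
cube-nondegenerate, is presentable. [this work] -/
theorem soloInformed_presentable_of_nondegenerateK_rational_of_subset
    (hK : ∀ c : K, IsAlgebraic ℚ (algebraMap K ℝ c)) (P Q : MvPolynomial (Fin n) K)
    (hND : SoloInformedCubeNondegenerateK Q) (r : IntegralRep n)
    (hr₁ : soloInformedOpenCube n ⊆ r.domain) (hr₂ : r.domain ⊆ soloInformedCube n)
    (hri : EqOn r.integrand (fun x => (MvPolynomial.aeval x P : ℝ) / MvPolynomial.aeval x Q)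
      (soloInformedOpenCube n)) :
    of r ∈ soloInformedPresentable := by
  set r₀ := r.restrict (soloInformedOpenCube n) (isSemialgebraic_soloInformedOpenCube n) hr₁
    with hr₀
  have h₀ : of r - of r₀ ∈ relations :=
    r.of_sub_of_restrict_mem_relations (isSemialgebraic_soloInformedOpenCube n) hr₁
      (measure_mono_null (fun x (hx : x ∈ r.domain \ soloInformedOpenCube n) =>
        show x ∈ soloInformedCube n \ soloInformedOpenCube n from ⟨hr₂ hx.1, hx.2⟩)
        (soloInformed_volume_cube_diff_openCube n))
  exact soloInformed_presentable_of_sub_mem h₀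
    (soloInformed_presentable_of_nondegenerateK_rational_open hK P Q hND r₀ rfl
      fun x hx => hri hx)

/-- **THEOREM ND-GEN over `K`, closed cube.** [this work] -/
theorem soloInformed_presentable_of_nondegenerateK_rational
    (hK : ∀ c : K, IsAlgebraic ℚ (algebraMap K ℝ c)) (P Q : MvPolynomial (Fin n) K)
    (hND : SoloInformedCubeNondegenerateK Q) (r : IntegralRep n)
    (hr : r.domain = soloInformedCube n)
    (hri : EqOn r.integrand (fun x => (MvPolynomial.aeval x P : ℝ) / MvPolynomial.aeval x Q)
      (soloInformedOpenCube n)) :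
    of r ∈ soloInformedPresentable :=
  soloInformed_presentable_of_nondegenerateK_rational_of_subset hK P Q hND r
    (hr ▸ soloInformedOpenCube_subset_cube n) hr.le hri

/-- **THEOREM ND-GEN over `K` in the output format of the cube crux**
`SoloInformedAyoubCubeResolutionCube`: every integrand `P/Q`, `P, Q ∈ K[x]`, `Q`
cube-nondegenerate, on a domain between the open and the closed unit cube admits an Ayoub cube
resolution inside the KZ calculus. [this work] -/
theorem soloInformed_cubeResolution_nondegenerateK_rational
    (hK : ∀ c : K, IsAlgebraic ℚ (algebraMap K ℝ c)) (P Q : MvPolynomial (Fin n) K)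
    (hND : SoloInformedCubeNondegenerateK Q) (r : IntegralRep n)
    (hr₁ : soloInformedOpenCube n ⊆ r.domain) (hr₂ : r.domain ⊆ soloInformedCube n)
    (hri : EqOn r.integrand (fun x => (MvPolynomial.aeval x P : ℝ) / MvPolynomial.aeval x Q)
      (soloInformedOpenCube n)) :
    ∃ (k : ℕ) (_ : k ≠ 0) (m : ℕ) (d : Fin m → ℕ) (G : ∀ j, SoloInformedCubeGerm (d j))
      (c : Fin m → ℤ) (ρ : ∀ j, IntegralRep (d j)),
      (∀ j, (ρ j).domain = soloInformedCube (d j)) ∧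
      (∀ j, EqOn (ρ j).integrand (fun x => ((G j).g (soloInformedToC (d j) x)).re)
        (soloInformedCube (d j))) ∧
      k • of r - ∑ j, c j • of (ρ j) ∈ relations :=
  soloInformed_exists_fin_of_presentable
    (soloInformed_presentable_of_nondegenerateK_rational_of_subset hK P Q hND r hr₁ hr₂ hri)

end Summit.KontsevichZagierPeriods.KontsevichZagierPeriods.Theorems
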